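import Summits.Parity.BatemanHorn.Theorems.RoughValueTransportBalancedSemiprimeLayerQuadraticSieveBookkeeping
import HarnessLib

/-!
# Quadratic sieve for the balanced-semiprime layer, 6/7: the bound at one large height

The line `smooth-modulus-twisted-hooley` of crux `BalancedSemiprimeLayer` (route
`RoughValueTransport`, item stmt-Parity-9469) bounds the relaxed sifted divisor family
`pairFamily f i δ c x` of a QUADRATIC coordinate `g = fᵢ = aX² + bX + c` of a Bateman–Horn system
`f` (window `m ∈ (x^{1−δ}, x^{1+δ}]`, `m ∣ g(n)`, `(m, B) = 1`, `B = |2a·disc g|`, every `fⱼ(n)`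
free of primes `< x^c`) by ONE `(k+1)`-dimensional upper-bound sieve: the pairs `(n, m)` are
booked at the value `F(n) = ∏ⱼ fⱼ(n)` and sifted by the primes `< z = x^c` (the tree's PROVED
Fundamental Lemma `SieveSequence.fundamental_lemma_explicit`); the main term comes from the window
sums of `ρ_g(m)/m` (the tree's PROVED `RhoLogSums.abs_rhoLogSum_sub_le`), the remainders ARE the
uniform Type-I information `UniformTypeI g` on dyadic blocks of `n`.  The proof is spread over
seven files `RoughValueTransportBalancedSemiprimeLayerQuadraticSieve<Part>.lean`, `<Part>` =
`Defs`, `Sequence`, `Remainder`, `Core`, `Bookkeeping`, `Height`, and the empty suffix (the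
registered stub `stub_quadraticSieve`).

This file: `bound_at_height` — for one height `x` with every largeness condition an explicit
hypothesis: `#pairFamily f i δ c x ≤ K·log 2/(c^{k+1} log x)·x/(log x)^k
+ 2Kδ/c^{k+1}·x/(log x)^k + C_low·x^{1−η}` (`K = mainConst`, `C_low = lowConst`), assembling
`card_pairFamily_le_add`, `card_pairFamily_filter_le`, `core_bound` + `typeI_blocks`,
`prod_one_sub_pairDensity_le`, `main_term_le` and `error_terms_le` at the parameters `z = x^c`,
`(U, V] = quadWindow`, `Y = ⌈x^{1−c}⌉`, `J = log₂⌊x/Y⌋ + 1`.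
-/

noncomputable section

open Polynomial Filter Finset
open Literature.NumberTheory.Sieve
open scoped ArithmeticFunction.Moebius NumberTheorySymbols

namespace Summit.Parity.BatemanHorn.Cruxes.BalancedSemiprimeLayer.SmoothModulusTwistedHooley

namespace QuadraticSieve

open Iwaniec1978 RhoLogSums PropertySTypeI

variable {a b c : ℤ}

/-! ### The bound at one large height -/

/-- The Bateman–Horn partial products are nonnegative. [folklore] -/
theorem batemanHornPartial_nonneg {k : ℕ} (f : Fin k → ℤ[X]) (y : ℕ) : 0 ≤ batemanHornPartial f y := by
  unfold batemanHornPartial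
  refine Finset.prod_nonneg fun p hp => mul_nonneg (pow_nonneg (inv_nonneg.mpr ?_) _) ?_
  · have hp2 : (2 : ℝ) ≤ p := by exact_mod_cast (Nat.prime_of_mem_primesLE hp).two_le
    have : (1 : ℝ) / p ≤ 1 / 2 := one_div_le_one_div_of_le (by norm_num) hp2
    linarith
  · have hp0 : (0 : ℝ) < p := by exact_mod_cast (Nat.prime_of_mem_primesLE hp).pos
    rw [sub_nonneg, div_le_one hp0]
    exact_mod_cast polyRootCountMod_le f p

section Height

variable {χ : DirichletCharacter ℂ (4 * (b ^ 2 - 4 * a * c).natAbs)}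

set_option maxHeartbeats 1600000 in
/-- **The bound at one large height** (every "`x` large" condition an explicit hypothesis).
For a quadratic coordinate `g = fᵢ = aX² + bX + c` of a Bateman–Horn system, the pair density of
dimension `κ` (constant `K`), `F = ∏ⱼ fⱼ > 0` beyond `n₀`, Type-I information for `g` with
exponents `θ, ε₀` beyond `y₀`, and exponents `0 < c ≤ 1/32`, `16c ≤ min(θ, ε₁)`,
`ε₁ ≤ min(ε₀, 1/2)`, `0 < δ ≤ c`, `η ≤ min(ε₁/2, c)`:
`#pairFamily f i δ c x ≤ K·log 2/(c^{k+1} log x)·x/(log x)^k + 2Kδ/c^{k+1}·x/(log x)^k + C_low·x^{1−η}`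
(`K = mainConst`, `C_low = lowConst`) as soon as the Bateman–Horn partial products at
`⌈x^c⌉ − 1` are `≤ 2C_f`, `≤ 2C_g`, `x^{c/2} ≥ 2`, `x^c > K_g`, `x^{1−δ} ≥ 4`,
`x^{1−c} ≥ y₀ + n₀ + 2` and `log x ≤ x^c`.  Proof: `card_pairFamily_le_add` +
`card_pairFamily_filter_le` + `core_bound` (with `typeI_blocks`), then `prod_one_sub_pairDensity_le`,
`main_term_le`, `error_terms_le`. [folklore] -/
theorem bound_at_height {k : ℕ} {f : Fin k → ℤ[X]} (hf : IsBatemanHornSystem f) (i : Fin k)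
    (ha : 0 < a) (hirr : Irreducible (quadPoly a b c)) (hg : f i = quadPoly a b c)
    (hBn : (2 * (f i).coeff 2 *
      discrim ((f i).coeff 2) ((f i).coeff 1) ((f i).coeff 0)).natAbs = badB a b c)
    (hχ : ∀ n : ℕ, Odd n → χ n = (J(b ^ 2 - 4 * a * c | n) : ℂ))
    [NeZero (4 * (b ^ 2 - 4 * a * c).natAbs)]
    {κ K : ℝ} (hκ : 0 < κ) (hdim : HasSieveDimension (pairDensity a b c (∏ j, f j)) κ K)
    {n₀ : ℕ} (hFpos : ∀ n : ℕ, n₀ ≤ n → 0 < (∏ j, f j).eval (n : ℤ))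
    {θ ε₀ KT : ℝ} (hθ : 0 < θ) {y₀ : ℕ}
    (hT : ∀ y : ℕ, y₀ ≤ y → ∀ q b₀ : ℕ, 1 ≤ q → (q : ℝ) ≤ (y : ℝ) ^ θ →
      ∀ ℓ N₁ N₂ : ℕ, 1 ≤ ℓ → (ℓ : ℝ) ≤ (y : ℝ) ^ θ → N₁ ≤ N₂ → (N₂ : ℝ) ≤ (y : ℝ) ^ (1 + θ) →
      |∑ n ∈ (Ioc N₁ N₂).filter (fun n : ℕ => ℓ ∣ n ∧ n.Coprime (q * badB a b c)),
        ((#((Ioc y (2 * y)).filter (fun t : ℕ => t % q = b₀ % q ∧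
            (n : ℤ) ∣ (quadPoly a b c).eval (t : ℤ))) : ℝ) -
          (y : ℝ) / q * (polyRootCountMod ![quadPoly a b c] n : ℝ) / n)| ≤
        KT * (y : ℝ) ^ (1 - ε₀))
    {Cf Cg cc δ ε₁ η : ℝ} (hcc0 : 0 < cc) (hcc32 : cc ≤ 1 / 32) (hccθ : 16 * cc ≤ θ)
    (hccε₁ : 16 * cc ≤ ε₁) (hε₁ε : ε₁ ≤ ε₀) (hε₁h : ε₁ ≤ 1 / 2)
    (hδ : 0 < δ) (hδcc : δ ≤ cc) (hηε : η ≤ ε₁ / 2) (hηcc : η ≤ cc)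
    {x : ℕ} (hx2 : 2 ≤ x)
    (h1 : batemanHornPartial f (⌈(x : ℝ) ^ cc⌉₊ - 1) ≤ 2 * Cf)
    (h2 : batemanHornPartial ![f i] (⌈(x : ℝ) ^ cc⌉₊ - 1) ≤ 2 * Cg)
    (h3 : (2 : ℝ) ≤ (x : ℝ) ^ (cc / 2)) (h4 : (sizeK a b c : ℝ) < (x : ℝ) ^ cc)
    (h5 : (4 : ℝ) ≤ (x : ℝ) ^ (1 - δ)) (h6 : ((y₀ + n₀ + 2 : ℕ) : ℝ) ≤ (x : ℝ) ^ (1 - cc))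
    (h7 : Real.log x ≤ (x : ℝ) ^ cc) :
    (#(pairFamily f i δ cc x) : ℝ) ≤
      mainConst χ (badQ a b c) (SieveSequence.flConst κ K) Cg Cf k * Real.log 2 /
          (cc ^ (k + 1) * Real.log x) * ((x : ℝ) / Real.log x ^ k) +
        2 * mainConst χ (badQ a b c) (SieveSequence.flConst κ K) Cg Cf k * δ / cc ^ (k + 1) *
          ((x : ℝ) / Real.log x ^ k) +
        lowConst χ (badQ a b c) KT cc * (x : ℝ) ^ (1 - η) := by
  -- ## notation
  set F : ℤ[X] := ∏ j, f j with hF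
  set Q₀ := badQ a b c with hQ₀
  set 𝔠 : ℝ := cMain χ Q₀ with h𝔠def
  set CFL : ℝ := SieveSequence.flConst κ K with hCFLdef
  set KV : ℝ := (Q₀ : ℝ) * Real.exp 6 * (2 * Cg) * (2 * Cf) * (2 * mertensA₁) ^ (k + 1) with hKVdef
  set KT' : ℝ := max KT 0 with hKT'
  set J' : ℕ := ⌈2 / cc⌉₊ with hJ'
  have hGF : quadPoly a b c ∣ F := hg ▸ Finset.dvd_prod_of_mem f (Finset.mem_univ i)
  have h𝔠 : 0 < 𝔠 := const_pos ha hirr hχ (squarefree_badQ a b c)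
  have hCFL : 0 ≤ CFL := (SieveSequence.flConst_pos hκ.le (lt_of_lt_of_le one_pos hdim.one_le)).le
  have hKT'0 : 0 ≤ KT' := le_max_right _ _
  have hCK0 : 0 ≤ winConst χ Q₀ := winConst_nonneg χ Q₀
  -- ## parameters at height `x`
  have hX2 : (2 : ℝ) ≤ (x : ℝ) := by exact_mod_cast hx2
  have hX1 : (1 : ℝ) < (x : ℝ) := by linarith
  have hX0 : (0 : ℝ) < (x : ℝ) := by linarith
  have hlogX : 0 < Real.log (x : ℝ) := Real.log_pos hX1
  have hmono : ∀ {u v : ℝ}, u ≤ v → (x : ℝ) ^ u ≤ (x : ℝ) ^ v := fun h =>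
    Real.rpow_le_rpow_of_exponent_le hX1.le h
  -- `z = x^c`
  obtain ⟨z, hzdef⟩ : ∃ z : ℝ, z = (x : ℝ) ^ cc := ⟨_, rfl⟩
  have hzsq : ((x : ℝ) ^ (cc / 2)) ^ 2 = z := by
    rw [hzdef, ← Real.rpow_natCast, ← Real.rpow_mul hX0.le]; norm_num
  have hz4 : 4 ≤ z := by
    have h := pow_le_pow_left₀ (by norm_num) h3 2
    rw [hzsq] at h; norm_num at h; exact h
  have hz2 : 2 ≤ z := by linarith
  have hz1 : 1 ≤ z := by linarith
  have hz0 : 0 < z := by linarith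
  have hlogz : Real.log (x : ℝ) ≤ z := hzdef ▸ h7
  -- the window `(U, V]`
  set U : ℕ := ⌈(x : ℝ) ^ (1 - δ)⌉₊ - 1 with hUdef
  set V : ℕ := ⌊(x : ℝ) ^ (1 + δ)⌋₊ with hVdef
  have hXδ0 : 0 < (x : ℝ) ^ (1 - δ) := Real.rpow_pos_of_pos hX0 _
  have hceil1 : 1 ≤ ⌈(x : ℝ) ^ (1 - δ)⌉₊ := Nat.ceil_pos.mpr hXδ0
  have hUw : ⌈(x : ℝ) ^ (1 - δ)⌉₊ = U + 1 := (Nat.sub_add_cancel hceil1).symm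
  have hUr : (U : ℝ) = ⌈(x : ℝ) ^ (1 - δ)⌉₊ - 1 := by
    rw [hUdef, Nat.cast_sub hceil1, Nat.cast_one]
  have hUge : (x : ℝ) ^ (1 - δ) / 2 ≤ U := by
    rw [hUr]; have := Nat.le_ceil ((x : ℝ) ^ (1 - δ)); linarith
  have hU1 : 1 ≤ U := by
    have : (1 : ℝ) ≤ U := by linarith
    exact_mod_cast this
  have hU0 : (0 : ℝ) < U := by exact_mod_cast hU1
  have hUle : (U : ℝ) ≤ (x : ℝ) ^ (1 - δ) := by
    rw [hUr]; have := Nat.ceil_lt_add_one hXδ0.le; linarith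
  have hVle : (V : ℝ) ≤ (x : ℝ) ^ (1 + δ) := Nat.floor_le (by positivity)
  have hUV : U ≤ V := Nat.le_floor (hUle.trans (hmono (by linarith)))
  -- `Y` and the blocks
  set Y : ℕ := ⌈(x : ℝ) ^ (1 - cc)⌉₊ with hYdef
  have hYge : (x : ℝ) ^ (1 - cc) ≤ Y := Nat.le_ceil _
  have hYle : (Y : ℝ) ≤ (x : ℝ) ^ (1 - cc) + 1 := (Nat.ceil_lt_add_one (by positivity)).le
  have h6' : ((y₀ : ℝ) + n₀ + 2) ≤ Y := by push_cast at h6; linarith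
  have hY₀ : y₀ ≤ Y := by
    have : (y₀ : ℝ) ≤ Y := by linarith
    exact_mod_cast this
  have hn₀Y : n₀ + 1 ≤ Y := by
    have : ((n₀ + 1 : ℕ) : ℝ) ≤ Y := by push_cast; linarith
    exact_mod_cast this
  have hY1 : 1 ≤ Y := le_trans (by omega) hn₀Y
  have hsplitX : (x : ℝ) ^ (1 - cc) * z = x := by
    rw [hzdef, ← Real.rpow_add hX0]; norm_num
  have hXcc1 : 1 ≤ (x : ℝ) ^ (1 - cc) := Real.one_le_rpow hX1.le (by linarith)
  have hYle2 : (Y : ℝ) ≤ 2 * (x : ℝ) ^ (1 - cc) := by linarith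
  have hYx : Y ≤ x := by
    have h4z : (x : ℝ) ^ (1 - cc) * 4 ≤ (x : ℝ) ^ (1 - cc) * z :=
      mul_le_mul_of_nonneg_left hz4 (by positivity)
    have : (Y : ℝ) ≤ x := by linarith
    exact_mod_cast this
  obtain ⟨hxJ, h2J, hJ1⟩ := dyadic_cover hY1 hYx
  set J : ℕ := Nat.log 2 (x / Y) + 1 with hJdef
  have hblocks : ∀ j ∈ range J, ((2 ^ j * Y : ℕ) : ℝ) ≤ x := by
    intro j hj
    have hj' : j ≤ Nat.log 2 (x / Y) := Nat.lt_succ_iff.mp (Finset.mem_range.mp hj)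
    have : 2 ^ j * Y ≤ 2 ^ Nat.log 2 (x / Y) * Y :=
      Nat.mul_le_mul_right Y (Nat.pow_le_pow_right two_pos hj')
    exact_mod_cast this.trans hJ1
  have hJle : (J : ℝ) ≤ 3 * z := by
    have h2pow : ((2 ^ Nat.log 2 (x / Y) : ℕ) : ℝ) ≤ x := by
      have : 2 ^ Nat.log 2 (x / Y) ≤ 2 ^ Nat.log 2 (x / Y) * Y := Nat.le_mul_of_pos_right _ hY1
      exact_mod_cast this.trans hJ1
    have hlg : (Nat.log 2 (x / Y) : ℝ) * Real.log 2 ≤ Real.log x := by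
      rw [← Real.log_pow]
      push_cast at h2pow
      exact Real.log_le_log (by positivity) h2pow
    have hl2 : (1 : ℝ) / 2 < Real.log 2 := by have := Real.log_two_gt_d9; linarith
    have hN0 : (0 : ℝ) ≤ Nat.log 2 (x / Y) := Nat.cast_nonneg _
    have hN1 : (Nat.log 2 (x / Y) : ℝ) * (1 / 2) ≤ Nat.log 2 (x / Y) * Real.log 2 :=
      mul_le_mul_of_nonneg_left hl2.le hN0
    have hN : (Nat.log 2 (x / Y) : ℝ) ≤ 2 * Real.log x := by linarith
    have hJr : (J : ℝ) = Nat.log 2 (x / Y) + 1 := by rw [hJdef]; push_cast; ring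
    rw [hJr]; linarith
  -- the Type-I hypothesis on the blocks
  have hccθ' : 0 ≤ (1 / 2 - cc) * θ := mul_nonneg (by linarith) hθ.le
  have hzY : z ≤ (Y : ℝ) ^ θ := by
    have h1' : ((x : ℝ) ^ (1 - cc)) ^ θ ≤ (Y : ℝ) ^ θ := Real.rpow_le_rpow (by positivity) hYge hθ.le
    rw [← Real.rpow_mul hX0.le] at h1'
    refine le_trans ?_ h1'
    rw [hzdef]
    refine hmono ?_
    linarith
  have hVY : (V : ℝ) ≤ (Y : ℝ) ^ (1 + θ) := by
    have h1' : ((x : ℝ) ^ (1 - cc)) ^ (1 + θ) ≤ (Y : ℝ) ^ (1 + θ) :=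
      Real.rpow_le_rpow (by positivity) hYge (by linarith)
    rw [← Real.rpow_mul hX0.le] at h1'
    refine hVle.trans (le_trans (hmono ?_) h1')
    linarith
  have HT := typeI_blocks (a := a) (b := b) (c := c) hθ.le hT hY₀ hY1 hblocks hzY hUV hVY hε₁ε
    (by linarith)
  -- `F > 0` on the blocks
  have hFposR : ∀ n ∈ Ioc Y (2 ^ J * Y), 0 < F.eval (n : ℤ) := fun n hn => by
    rw [Finset.mem_Ioc] at hn
    exact hFpos n (by omega)
  -- ## the core bound
  have hET0 : 0 ≤ KT' * (x : ℝ) ^ (1 - ε₁) := by positivity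
  have hcore := core_bound (χ := χ) (F := F) (U := U) (V := V) (Y := Y) (J := J) (z := z)
    (ET := max KT 0 * (x : ℝ) ^ (1 - ε₁)) ha hirr hχ hGF hκ hdim hU1 hUV hFposR hz2 hET0 HT
  -- name the quantities of the core bound
  set VG : ℝ := ∏ p ∈ Nat.primesBelow ⌈z⌉₊, (1 - pairDensity a b c F p) with hVGdef
  set L : ℝ := Real.log ((V : ℝ) / U) with hLdef
  set yT : ℝ := yTot Y J with hyTdef
  set KVv : ℝ := kWin χ Q₀ V with hKVvdef
  have hcore' : ∑ m ∈ (Ioc U V).filter (fun m : ℕ => m.Coprime (badB a b c)),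
      (#((Ioc Y (2 ^ J * Y)).filter fun n : ℕ => (m : ℤ) ∣ (quadPoly a b c).eval (n : ℤ) ∧
        (F.eval (n : ℤ)).natAbs.Coprime (primesProdBelow z)) : ℝ) ≤
      (1 + CFL) * (𝔠 * L * yT) * VG + z ^ 2 * ((J : ℝ) * z * (KT' * (x : ℝ) ^ (1 - ε₁)) +
        yT * z * (2 * 𝔠 / U + 4 * (KVv * z ^ 3) / Real.sqrt U)) := hcore
  clear hcore HT hT
  -- ## the split of `pairFamily` at `n = Y`
  have hsplit := card_pairFamily_le_add f i hg hBn δ cc x hUw rfl hxJ (Y := Y)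
  rw [← hzdef] at hsplit
  have hsplitR : (#(pairFamily f i δ cc x) : ℝ) ≤
      (#((pairFamily f i δ cc x).filter (fun nm : ℕ × ℕ => nm.1 ≤ Y)) : ℝ) +
      ∑ m ∈ (Ioc U V).filter (fun m : ℕ => m.Coprime (badB a b c)),
        (#((Ioc Y (2 ^ J * Y)).filter fun n : ℕ => (m : ℤ) ∣ (quadPoly a b c).eval (n : ℤ) ∧
          (F.eval (n : ℤ)).natAbs.Coprime (primesProdBelow z)) : ℝ) := by
    exact_mod_cast hsplit
  -- the pairs with `n ≤ Y`
  have hbound : (sizeK a b c : ℝ) * (Y : ℝ) ^ 2 < ((⌈(x : ℝ) ^ cc⌉₊ ^ (J' + 1) : ℕ) : ℝ) := by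
    have hK1 : (1 : ℝ) ≤ sizeK a b c := one_le_sizeK ha
    have hY2 : (Y : ℝ) ^ 2 ≤ (2 * (x : ℝ) ^ (1 - cc)) ^ 2 :=
      pow_le_pow_left₀ (Nat.cast_nonneg _) hYle2 2
    have hsq : ((x : ℝ) ^ (1 - cc)) ^ 2 = (x : ℝ) ^ (2 - 2 * cc) := by
      rw [← Real.rpow_natCast, ← Real.rpow_mul hX0.le]; ring_nf
    have hx2cc : 0 < (x : ℝ) ^ (2 - 2 * cc) := Real.rpow_pos_of_pos hX0 _
    have hstep1 : (sizeK a b c : ℝ) * (Y : ℝ) ^ 2 < z * (4 * (x : ℝ) ^ (2 - 2 * cc)) := by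
      calc (sizeK a b c : ℝ) * (Y : ℝ) ^ 2 ≤ (sizeK a b c : ℝ) * (4 * (x : ℝ) ^ (2 - 2 * cc)) := by
            refine mul_le_mul_of_nonneg_left ?_ (by linarith)
            calc (Y : ℝ) ^ 2 ≤ (2 * (x : ℝ) ^ (1 - cc)) ^ 2 := hY2
              _ = 4 * (x : ℝ) ^ (2 - 2 * cc) := by rw [mul_pow, hsq]; norm_num
        _ < z * (4 * (x : ℝ) ^ (2 - 2 * cc)) :=
            mul_lt_mul_of_pos_right (hzdef ▸ h4) (by positivity)
    have hstep2 : z * (4 * (x : ℝ) ^ (2 - 2 * cc)) ≤ (x : ℝ) ^ (2 : ℝ) := by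
      have e : z * (z * (x : ℝ) ^ (2 - 2 * cc)) = (x : ℝ) ^ (2 : ℝ) := by
        rw [hzdef, ← Real.rpow_add hX0, ← Real.rpow_add hX0]; ring_nf
      have : z * (4 * (x : ℝ) ^ (2 - 2 * cc)) ≤ z * (z * (x : ℝ) ^ (2 - 2 * cc)) :=
        mul_le_mul_of_nonneg_left (mul_le_mul_of_nonneg_right hz4 hx2cc.le) hz0.le
      linarith
    have hJ'cc : 2 ≤ cc * (J' + 1 : ℕ) := by
      have hJ'ge : 2 / cc ≤ J' := Nat.le_ceil _
      rw [div_le_iff₀ hcc0] at hJ'ge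
      push_cast
      linarith only [hJ'ge, hcc0.le]
    have hstep3 : (x : ℝ) ^ (2 : ℝ) ≤ ((⌈(x : ℝ) ^ cc⌉₊ ^ (J' + 1) : ℕ) : ℝ) := by
      calc (x : ℝ) ^ (2 : ℝ) ≤ (x : ℝ) ^ (cc * (J' + 1 : ℕ)) := hmono hJ'cc
        _ = z ^ (J' + 1) := by rw [hzdef, Real.rpow_mul hX0.le, Real.rpow_natCast]
        _ ≤ (⌈z⌉₊ : ℝ) ^ (J' + 1) := pow_le_pow_left₀ hz0.le (Nat.le_ceil z) _
        _ = ((⌈(x : ℝ) ^ cc⌉₊ ^ (J' + 1) : ℕ) : ℝ) := by rw [hzdef]; push_cast; rfl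
    linarith
  have hsmall := card_pairFamily_filter_le f i ha hg δ cc x hY1 hbound
  have hsmallR : (#((pairFamily f i δ cc x).filter (fun nm : ℕ × ℕ => nm.1 ≤ Y)) : ℝ) ≤
      (Y : ℝ) * 2 ^ J' := by exact_mod_cast hsmall
  have hsmall' : (Y : ℝ) * 2 ^ J' ≤ 2 ^ (J' + 1) * (x : ℝ) ^ (1 - η) := by
    have : (x : ℝ) ^ (1 - cc) ≤ (x : ℝ) ^ (1 - η) := hmono (by linarith)
    calc (Y : ℝ) * 2 ^ J' ≤ (2 * (x : ℝ) ^ (1 - η)) * 2 ^ J' :=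
          mul_le_mul_of_nonneg_right (by linarith) (by positivity)
      _ = 2 ^ (J' + 1) * (x : ℝ) ^ (1 - η) := by ring
  -- ## the sieve product `V(z)`
  rw [← hzdef] at h1 h2
  have hceil4 : 4 ≤ ⌈z⌉₊ := by
    have : (4 : ℝ) ≤ ⌈z⌉₊ := hz4.trans (Nat.le_ceil z)
    exact_mod_cast this
  set y' : ℕ := ⌈z⌉₊ - 1 with hy'
  have hy'2 : 2 ≤ y' := by omega
  have hy'r : (y' : ℝ) = ⌈z⌉₊ - 1 := by rw [hy', Nat.cast_sub (by omega), Nat.cast_one]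
  have hy'ge : z / 2 ≤ y' := by rw [hy'r]; have := Nat.le_ceil z; linarith
  have hlogy' : cc / 2 * Real.log x ≤ Real.log y' := by
    have hl2 : Real.log 2 ≤ cc / 2 * Real.log x := by
      have := Real.log_le_log (by norm_num) h3
      rwa [Real.log_rpow hX0] at this
    have hlz : Real.log z = cc * Real.log x := by rw [hzdef, Real.log_rpow hX0]
    have : Real.log (z / 2) ≤ Real.log y' := Real.log_le_log (by positivity) hy'ge
    rw [Real.log_div hz0.ne' two_ne_zero, hlz] at this
    linarith
  have hlogy'0 : 0 < Real.log y' := lt_of_lt_of_le (by positivity) hlogy'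
  set M : ℝ := ∏ p ∈ Nat.primesLE y', (1 - 1 / (p : ℝ)) with hMdef
  have hM0 : 0 ≤ M := Finset.prod_nonneg fun p hp => by
    have : (2 : ℝ) ≤ p := by exact_mod_cast (Nat.prime_of_mem_primesLE hp).two_le
    have : (1 : ℝ) / p ≤ 1 / 2 := one_div_le_one_div_of_le (by norm_num) this
    linarith
  have hMle : M ≤ 2 * mertensA₁ / (cc * Real.log x) := by
    calc M ≤ Real.exp (6 / Real.log 2) * (Real.log 2 / Real.log y') :=
          Lichtman2020.prod_primesLE_one_sub_inv_le hy'2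
      _ = mertensA₁ / Real.log y' := by rw [mertensA₁]; ring
      _ ≤ mertensA₁ / (cc / 2 * Real.log x) :=
          div_le_div_of_nonneg_left mertensA₁_pos.le (by positivity) hlogy'
      _ = 2 * mertensA₁ / (cc * Real.log x) := by field_simp
  have hVG1 : VG ≤ (Q₀ : ℝ) * Real.exp 6 * batemanHornPartial ![f i] y' *
      batemanHornPartial f y' * M ^ (k + 1) := by
    rw [hVGdef, Nat.primesBelow_eq_primesLE_sub_one]
    exact prod_one_sub_pairDensity_le ha hirr i hg hf.hasNoFixedPrimeDivisor y'
  have hVG : VG ≤ KV / (cc * Real.log x) ^ (k + 1) :=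
    densityProd_le k hVG1 (by positivity) (batemanHornPartial_nonneg _ _) h2
      (batemanHornPartial_nonneg _ _) h1 hM0 hMle
  have hVG0 : 0 ≤ VG := Finset.prod_nonneg fun p hp =>
    (sub_pos.mpr (hdim.1 p (Nat.prime_of_mem_primesBelow hp)).2).le
  -- ## `L`, `yTot`, `K_V`
  have hL : L ≤ Real.log 2 + 2 * δ * Real.log x := by
    have e : (x : ℝ) ^ (2 * δ) * (x : ℝ) ^ (1 - δ) = (x : ℝ) ^ (1 + δ) := by
      rw [← Real.rpow_add hX0]; ring_nf
    have h2U : (x : ℝ) ^ (1 - δ) ≤ 2 * U := by linarith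
    have hVU : (V : ℝ) ≤ 2 * (x : ℝ) ^ (2 * δ) * U := by
      calc (V : ℝ) ≤ (x : ℝ) ^ (1 + δ) := hVle
        _ = (x : ℝ) ^ (2 * δ) * (x : ℝ) ^ (1 - δ) := e.symm
        _ ≤ (x : ℝ) ^ (2 * δ) * (2 * U) :=
            mul_le_mul_of_nonneg_left h2U (Real.rpow_nonneg hX0.le _)
        _ = 2 * (x : ℝ) ^ (2 * δ) * U := by ring
    have hV0 : (0 : ℝ) < V := lt_of_lt_of_le hU0 (by exact_mod_cast hUV)
    have hVU' : (V : ℝ) / U ≤ 2 * (x : ℝ) ^ (2 * δ) := by rw [div_le_iff₀ hU0]; exact hVU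
    calc L = Real.log ((V : ℝ) / U) := rfl
      _ ≤ Real.log (2 * (x : ℝ) ^ (2 * δ)) := Real.log_le_log (div_pos hV0 hU0) hVU'
      _ = Real.log 2 + 2 * δ * Real.log x := by
          rw [Real.log_mul two_ne_zero (Real.rpow_pos_of_pos hX0 _).ne', Real.log_rpow hX0]
  have hyT : yT ≤ 2 * (x : ℝ) := (yTot_le Y J).trans (by exact_mod_cast h2J)
  have hKVv0 : 0 ≤ KVv := kWin_nonneg χ Q₀ (le_trans hU1 hUV)
  have hKVv : KVv ≤ winConst χ Q₀ * (3 * z) := by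
    have hV1 : 1 ≤ V := le_trans hU1 hUV
    have hV1r : (1 : ℝ) ≤ V := by exact_mod_cast hV1
    have hlogV0 : 0 ≤ Real.log V := Real.log_nonneg hV1r
    have hlogV : Real.log V ≤ 2 * Real.log x := by
      have h' : Real.log V ≤ Real.log ((x : ℝ) ^ (1 + δ)) := Real.log_le_log (by linarith) hVle
      rw [Real.log_rpow hX0] at h'
      have h'' : δ * Real.log x ≤ 1 * Real.log x :=
        mul_le_mul_of_nonneg_right (by linarith) hlogX.le
      linarith only [h', h'']
    have h3z : 1 + Real.log V ≤ 3 * z := by linarith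
    calc KVv ≤ winConst χ Q₀ * (1 + Real.log V) := kWin_le_winConst χ Q₀ hV1
      _ ≤ winConst χ Q₀ * (3 * z) := mul_le_mul_of_nonneg_left h3z hCK0
  -- ## the main term and the error terms
  have hmain := main_term_le k hX1 hcc0 hδ.le hCFL h𝔠.le hL (yTot_nonneg Y J) hyT hVG0 hVG
  have herr := error_terms_le (η := η) hX1.le hzdef hcc32 hδ.le hδcc hccε₁ hηε hηcc hKT'0 h𝔠.le
    hCK0 hJle hET0 le_rfl hyT hUge hKVv0 hKVv
  have hsmall'' : (#((pairFamily f i δ cc x).filter (fun nm : ℕ × ℕ => nm.1 ≤ Y)) : ℝ) ≤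
      2 ^ (J' + 1) * (x : ℝ) ^ (1 - η) := hsmallR.trans hsmall'
  have hlow : lowConst χ Q₀ KT cc * (x : ℝ) ^ (1 - η) =
      (3 * KT' + 8 * 𝔠 + 24 * Real.sqrt 2 * winConst χ Q₀) * (x : ℝ) ^ (1 - η) +
        2 ^ (J' + 1) * (x : ℝ) ^ (1 - η) := by
    simp only [lowConst, hKT', h𝔠def, hJ']; ring
  have hKm : mainConst χ Q₀ CFL Cg Cf k = (1 + CFL) * 𝔠 * 2 * KV := rfl
  rw [hKm, hlow]
  linarith only [hsplitR, hsmall'', hcore', herr, hmain]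

end Height

end QuadraticSieve

/-- **Anchor of part 6/7**: the registered sub-goal `stub_quadraticSieve_part6` of
`stub_quadraticSieve` (`ledger workitem stub-add`), through which this helper file lands
`--supports stmt-Parity-9469`:
nonnegativity of the Bateman–Horn partial products (the positivity used by `bound_at_height`). [folklore] -/
theorem stub_quadraticSieve_part6 :
    ∀ (k : ℕ) (f : Fin k → ℤ[X]) (y : ℕ), 0 ≤ batemanHornPartial f y :=
  fun _ f y => QuadraticSieve.batemanHornPartial_nonneg f y

end Summit.Parity.BatemanHorn.Cruxes.BalancedSemiprimeLayer.SmoothModulusTwistedHooley
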